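import Mathlib
import Literature.NumberTheory.Automorphic.HilbertModularFormQExpansion
import Summits.Langlands.Langlands.Theorems.CapacityClassicalityHilbertIntegralOverconvergentIsCongruenceKoecherPrinciple
import Summits.Langlands.Langlands.Theorems.CapacityClassicalityHilbertIntegralOverconvergentIsCongruenceStubConjPrincipalCongruence

/-!
# Hilbert modular forms of level `Γ₁(𝔫)` are `𝓞 F`-periodic (stub P5 of line Sketch-ideate-r1-k1)

Stub `stub_modularForm_periodic` of line Sketch-ideate-r1-k1 of the crux `HilbertIntegralOverconvergentIsCongruence`
(stmt-Langlands-8485), section P (the `q`-expansion principle over `ℂ`): a Hilbert modular form `f ∈ M_k(Γ₁(𝔫))`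
satisfies `f(z + a) = f(z)` for every `a ∈ 𝓞 F` and `z ∈ ℍ`.

Proof: the translation matrix `E₁₂(a) = (1 a; 0 1)` (the tree's `SL2Rel.e12 a`) lies in `Γ₁(𝔫)` (its lower row is
`(0, 1)`), its image in `SL₂(F)` is `(1 a; 0 1)` (`cpc_coe_toSL2F_e12`), which acts on `ℍ` by `z ↦ z + a` with
automorphy factor `1` (`kp_moeb_transl`); the transformation law of `f` then reads `f(z + a) = 1 · f(z)`.
-/

set_option linter.dupNamespace false

noncomputable section

namespace Summit.Langlands.Langlands.Theorems.HilbertIntegralOverconvergentIsCongruence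

open MeasureTheory Complex NumberField
open Literature.NumberTheory.Automorphic Literature.NumberTheory.Automorphic.HilbertModular
open scoped MatrixGroups

/-- The translation matrix `E₁₂(a) = (1 a; 0 1)` lies in `Γ₁(𝔫)` for every ideal `𝔫`. -/
theorem mfp_e12_mem_Gamma1 {R : Type*} [CommRing R] (𝔫 : Ideal R) (a : R) :
    SL2Rel.e12 a ∈ Bianchi.Gamma1 𝔫 := by
  rw [Bianchi.mem_Gamma1, SL2Rel.e12_apply_10, SL2Rel.e12_apply_11, sub_self]
  exact ⟨𝔫.zero_mem, 𝔫.zero_mem⟩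

/-- **Stub P5 (`stub_modularForm_periodic`).** Hilbert modular forms of level `Γ₁(𝔫)` are `𝓞 F`-periodic on `ℍ` (the
translations `(1 a; 0 1)`, `a ∈ 𝓞 F`, lie in `Γ₁(𝔫)` and act by `z ↦ z + a` with automorphy factor `1`). [folklore] -/
theorem stub_modularForm_periodic (F : Type) [Field F] [NumberField F] (𝔫 : Ideal (𝓞 F)) (k : (F →+* ℝ) → ℤ)
    (f : Point F → ℂ) (hf : f ∈ modularForms (Bianchi.Gamma1 𝔫) k) :
    ∀ (a : 𝓞 F) (z : Point F), z ∈ halfSpace F → f (fun σ ↦ z σ + ((σ (a : F) : ℝ) : ℂ)) = f z := by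
  intro a z hz
  obtain ⟨hmoeb, haut⟩ := kp_moeb_transl (cpc_coe_toSL2F_e12 a) k z
  have key := (mem_modularForms_iff.mp hf).transform (SL2Rel.e12 a) (mfp_e12_mem_Gamma1 𝔫 a) z hz
  rwa [hmoeb, haut, one_mul] at key

end Summit.Langlands.Langlands.Theorems.HilbertIntegralOverconvergentIsCongruence
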